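import Mathlib
import Summits.MatrixMultiplication.MatrixMultiplication.Theses.CondensationDistance

/-!
# `CondensationDistance.CondensationSound` (stmt-MatrixMultiplication-15939) — Negative lane, III-a:
# the fan-in invariant for division SLPs (one step)

Tool file for `FanInBound.lean` (the radius-1 ball of the crux cannot be widened to radius 2).
In the tree model `DivStep`/`DivSeq`/`Derivable` over `ℂ(σ) = Frac ℂ[σ]` we carry, along a
computation sequence, for every available element `x`:
* a SUPPORT `V x : Finset σ` — `x = p/q` with `q ≠ 0` and `p, q` free of every variable outside
  `V x` (`deg_w p = deg_w q = 0` for `w ∉ V x`; lemmas `suppRep_mono/_X/_const/_step`);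
* an ANCESTOR set `anc x ⊆ E ⊆ A'`, `E` the entries computed so far;
* the submodular count `|⋃_{x ∈ X} V x| ≤ |⋃_{x ∈ X} anc x| + |X|` for all finite `X ⊆ A'`
  (fan-in 2: the `2k` operand slots of `k` steps hold `≥ k − 1` earlier results).
`inv_step`: one Ω-step preserves this invariant and grows `E` by at most one.  The invariant is
written inline (no new definitions).  Crux disprover, cycle 1
(`Cruxes/CondensationSound/Disproof.lean` §(c)); the crux itself is true as typed.
-/

set_option linter.dupNamespace false

noncomputable section

open scoped Classical
open MvPolynomial Literature.Computability.AlgebraicComplexity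

namespace Summit.MatrixMultiplication.MatrixMultiplication.Theorems

namespace CondensationSoundNeg

variable {σ : Type*}

/-- Monotonicity of "supported on `W`" in `W`. [folklore] -/
theorem suppRep_mono {W W' : Finset σ} {x : FractionRing (MvPolynomial σ ℂ)}
    (h : (∃ p q : MvPolynomial σ ℂ, q ≠ 0 ∧
      algebraMap (MvPolynomial σ ℂ) (FractionRing (MvPolynomial σ ℂ)) q * x =
        algebraMap (MvPolynomial σ ℂ) (FractionRing (MvPolynomial σ ℂ)) p ∧
      ∀ w, w ∉ W → degreeOf w p = 0 ∧ degreeOf w q = 0))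
    (hW : W ⊆ W') : (∃ p q : MvPolynomial σ ℂ, q ≠ 0 ∧
      algebraMap (MvPolynomial σ ℂ) (FractionRing (MvPolynomial σ ℂ)) q * x =
        algebraMap (MvPolynomial σ ℂ) (FractionRing (MvPolynomial σ ℂ)) p ∧
      ∀ w, w ∉ W' → degreeOf w p = 0 ∧ degreeOf w q = 0) := by
  obtain ⟨p, q, hq, e, hz⟩ := h
  exact ⟨p, q, hq, e, fun w hw => hz w fun h' => hw (hW h')⟩

/-- An indeterminate `X v` is supported on `{v}`. [folklore] -/
theorem suppRep_X (v : σ) :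
    (∃ p q : MvPolynomial σ ℂ, q ≠ 0 ∧
      algebraMap (MvPolynomial σ ℂ) (FractionRing (MvPolynomial σ ℂ)) q * algebraMap (MvPolynomial σ ℂ) (FractionRing (MvPolynomial σ ℂ)) (X v) =
        algebraMap (MvPolynomial σ ℂ) (FractionRing (MvPolynomial σ ℂ)) p ∧
      ∀ w, w ∉ ({v} : Finset σ) → degreeOf w p = 0 ∧ degreeOf w q = 0) := by
  refine ⟨X v, 1, one_ne_zero, by simp, fun w hw => ⟨?_, ?_⟩⟩
  · rw [degreeOf_X]
    simp only [Finset.mem_singleton] at hw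
    simp [hw]
  · rw [← C_1, degreeOf_C]

/-- A constant is supported on every `W`. [folklore] -/
theorem suppRep_const (W : Finset σ) (c : ℂ) :
    (∃ p q : MvPolynomial σ ℂ, q ≠ 0 ∧
      algebraMap (MvPolynomial σ ℂ) (FractionRing (MvPolynomial σ ℂ)) q * algebraMap ℂ (FractionRing (MvPolynomial σ ℂ)) c =
        algebraMap (MvPolynomial σ ℂ) (FractionRing (MvPolynomial σ ℂ)) p ∧
      ∀ w, w ∉ W → degreeOf w p = 0 ∧ degreeOf w q = 0) := by
  refine ⟨C c, 1, one_ne_zero, ?_, fun w _ => ⟨degreeOf_C _ _, by rw [← C_1, degreeOf_C]⟩⟩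
  rw [IsScalarTower.algebraMap_apply ℂ (MvPolynomial σ ℂ) (FractionRing (MvPolynomial σ ℂ)),
    MvPolynomial.algebraMap_eq]
  simp

/-- The algebra of one Ω-step: if both operands are `p/q` with `p, q` free of the variables
outside `W`, so is `c • x + d • y`, `x * y` and `x⁻¹`. [folklore] -/
theorem suppRep_step {W : Finset σ} {x y v : FractionRing (MvPolynomial σ ℂ)}
    (hx : (∃ p q : MvPolynomial σ ℂ, q ≠ 0 ∧
      algebraMap (MvPolynomial σ ℂ) (FractionRing (MvPolynomial σ ℂ)) q * x =
        algebraMap (MvPolynomial σ ℂ) (FractionRing (MvPolynomial σ ℂ)) p ∧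
      ∀ w, w ∉ W → degreeOf w p = 0 ∧ degreeOf w q = 0))
    (hy : (∃ p q : MvPolynomial σ ℂ, q ≠ 0 ∧
      algebraMap (MvPolynomial σ ℂ) (FractionRing (MvPolynomial σ ℂ)) q * y =
        algebraMap (MvPolynomial σ ℂ) (FractionRing (MvPolynomial σ ℂ)) p ∧
      ∀ w, w ∉ W → degreeOf w p = 0 ∧ degreeOf w q = 0))
    (hv : (∃ c d : ℂ, v = c • x + d • y) ∨ v = x * y ∨ (x ≠ 0 ∧ v = x⁻¹)) :
    (∃ p q : MvPolynomial σ ℂ, q ≠ 0 ∧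
      algebraMap (MvPolynomial σ ℂ) (FractionRing (MvPolynomial σ ℂ)) q * v =
        algebraMap (MvPolynomial σ ℂ) (FractionRing (MvPolynomial σ ℂ)) p ∧
      ∀ w, w ∉ W → degreeOf w p = 0 ∧ degreeOf w q = 0) := by
  obtain ⟨p₁, q₁, hq₁, e₁, z₁⟩ := hx
  obtain ⟨p₂, q₂, hq₂, e₂, z₂⟩ := hy
  set ιR := algebraMap (MvPolynomial σ ℂ) (FractionRing (MvPolynomial σ ℂ)) with hιR
  have zmul : ∀ (w : σ) (a b : MvPolynomial σ ℂ), degreeOf w a = 0 → degreeOf w b = 0 →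
      degreeOf w (a * b) = 0 := fun w a b ha hb => by
    have := degreeOf_mul_le w a b; omega
  rcases hv with ⟨c, d, rfl⟩ | rfl | ⟨hx0, rfl⟩
  · refine ⟨C c * (p₁ * q₂) + C d * (p₂ * q₁), q₁ * q₂, mul_ne_zero hq₁ hq₂, ?_, fun w hw => ?_⟩
    · rw [Algebra.smul_def, Algebra.smul_def,
        IsScalarTower.algebraMap_apply ℂ (MvPolynomial σ ℂ) (FractionRing (MvPolynomial σ ℂ)) c,
        IsScalarTower.algebraMap_apply ℂ (MvPolynomial σ ℂ) (FractionRing (MvPolynomial σ ℂ)) d,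
        MvPolynomial.algebraMap_eq]
      simp only [map_add, map_mul]
      linear_combination (ιR (C c) * ιR q₂) * e₁ + (ιR (C d) * ιR q₁) * e₂
    · obtain ⟨a₁, b₁⟩ := z₁ w hw
      obtain ⟨a₂, b₂⟩ := z₂ w hw
      refine ⟨?_, zmul w _ _ b₁ b₂⟩
      have h1 := zmul w _ _ (degreeOf_C c w) (zmul w _ _ a₁ b₂)
      have h2 := zmul w _ _ (degreeOf_C d w) (zmul w _ _ a₂ b₁)
      have := degreeOf_add_le w (C c * (p₁ * q₂)) (C d * (p₂ * q₁))
      rw [h1, h2] at this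
      omega
  · refine ⟨p₁ * p₂, q₁ * q₂, mul_ne_zero hq₁ hq₂, ?_, fun w hw => ?_⟩
    · simp only [map_mul]
      linear_combination (ιR q₂ * y) * e₁ + (ιR p₁) * e₂
    · obtain ⟨a₁, b₁⟩ := z₁ w hw
      obtain ⟨a₂, b₂⟩ := z₂ w hw
      exact ⟨zmul w _ _ a₁ a₂, zmul w _ _ b₁ b₂⟩
  · have hp₁ : p₁ ≠ 0 := by
      rintro rfl
      rw [map_zero, mul_eq_zero] at e₁
      rcases e₁ with h0 | h0
      · exact hq₁ ((IsFractionRing.injective (MvPolynomial σ ℂ)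
          (FractionRing (MvPolynomial σ ℂ))) (by rw [h0, map_zero]))
      · exact hx0 h0
    refine ⟨q₁, p₁, hp₁, ?_, fun w hw => ⟨(z₁ w hw).2, (z₁ w hw).1⟩⟩
    rw [← e₁, mul_assoc, mul_inv_cancel₀ hx0, mul_one]

/-- THE FAN-IN INVARIANT on an available set `A'` (used inline below): a support assignment
`V : ℂ(σ) → Finset σ` (every `x ∈ A'` is `p/q` with `p, q` free of the variables outside `V x`),
an ancestor assignment `anc : ℂ(σ) → Finset ℂ(σ)` with `anc x ⊆ E ⊆ A'` (`E` = the entries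
computed so far), and the submodular count `|⋃_{x ∈ X} V x| ≤ |⋃_{x ∈ X} anc x| + |X|` for every
finite `X ⊆ A'`.  Operand data: an operand `a ∈ A' ∪ consts` of a step is covered by a set
`Sa ⊆ A'` with `|Sa| ≤ 1` (`{a}`, or `∅` for a constant) on whose support `a` lives. [folklore] -/
theorem operand_data {A' : Set (FractionRing (MvPolynomial σ ℂ))}
    {E : Finset (FractionRing (MvPolynomial σ ℂ))} {V : FractionRing (MvPolynomial σ ℂ) → Finset σ}
    {anc : FractionRing (MvPolynomial σ ℂ) → Finset (FractionRing (MvPolynomial σ ℂ))}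
    (hI : ((∀ x ∈ A', (∃ p q : MvPolynomial σ ℂ, q ≠ 0 ∧
      algebraMap (MvPolynomial σ ℂ) (FractionRing (MvPolynomial σ ℂ)) q * x =
        algebraMap (MvPolynomial σ ℂ) (FractionRing (MvPolynomial σ ℂ)) p ∧
      ∀ w, w ∉ (V x) → degreeOf w p = 0 ∧ degreeOf w q = 0)) ∧
    (∀ x ∈ A', anc x ⊆ E) ∧ ((↑E : Set (FractionRing (MvPolynomial σ ℂ))) ⊆ A') ∧
    ∀ X : Finset (FractionRing (MvPolynomial σ ℂ)), (↑X : Set (FractionRing (MvPolynomial σ ℂ))) ⊆ A' →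
      (X.biUnion V).card ≤ (X.biUnion anc).card + X.card))
    {a : FractionRing (MvPolynomial σ ℂ)}
    (ha : a ∈ A' ∪ Set.range (algebraMap ℂ (FractionRing (MvPolynomial σ ℂ)))) :
    ∃ Sa : Finset (FractionRing (MvPolynomial σ ℂ)), (↑Sa : Set _) ⊆ A' ∧ Sa.card ≤ 1 ∧
      (∃ p q : MvPolynomial σ ℂ, q ≠ 0 ∧
      algebraMap (MvPolynomial σ ℂ) (FractionRing (MvPolynomial σ ℂ)) q * a =
        algebraMap (MvPolynomial σ ℂ) (FractionRing (MvPolynomial σ ℂ)) p ∧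
      ∀ w, w ∉ (Sa.biUnion V) → degreeOf w p = 0 ∧ degreeOf w q = 0) := by
  rcases ha with ha | ⟨c, rfl⟩
  · refine ⟨{a}, by simpa using ha, by simp, ?_⟩
    rw [Finset.singleton_biUnion]
    exact hI.1 a ha
  · exact ⟨∅, by simp, by simp, suppRep_const _ c⟩

/-- **One Ω-step preserves the fan-in invariant**, growing `E` by at most one: the new element
`v` gets `V' v = ⋃_{Sa ∪ Sb} V`, `anc' v = {v} ∪ ⋃_{Sa ∪ Sb} anc`; for `X ∋ v` compare with
`X' = (X ∖ v) ∪ Sa ∪ Sb ⊆ A'` (`|X'| ≤ |X| + 1`, `⋃_X V' ⊆ ⋃_{X'} V`,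
`{v} ⊔ ⋃_{X'} anc ⊆ ⋃_X anc'`). [folklore] -/
theorem inv_step {A' : Set (FractionRing (MvPolynomial σ ℂ))}
    {E : Finset (FractionRing (MvPolynomial σ ℂ))} {V : FractionRing (MvPolynomial σ ℂ) → Finset σ}
    {anc : FractionRing (MvPolynomial σ ℂ) → Finset (FractionRing (MvPolynomial σ ℂ))}
    (hI : ((∀ x ∈ A', (∃ p q : MvPolynomial σ ℂ, q ≠ 0 ∧
      algebraMap (MvPolynomial σ ℂ) (FractionRing (MvPolynomial σ ℂ)) q * x =
        algebraMap (MvPolynomial σ ℂ) (FractionRing (MvPolynomial σ ℂ)) p ∧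
      ∀ w, w ∉ (V x) → degreeOf w p = 0 ∧ degreeOf w q = 0)) ∧
    (∀ x ∈ A', anc x ⊆ E) ∧ ((↑E : Set (FractionRing (MvPolynomial σ ℂ))) ⊆ A') ∧
    ∀ X : Finset (FractionRing (MvPolynomial σ ℂ)), (↑X : Set (FractionRing (MvPolynomial σ ℂ))) ⊆ A' →
      (X.biUnion V).card ≤ (X.biUnion anc).card + X.card))
    {v : FractionRing (MvPolynomial σ ℂ)} (hv : DivStep ℂ A' v) :
    ∃ (E' : Finset (FractionRing (MvPolynomial σ ℂ))) (V' : FractionRing (MvPolynomial σ ℂ) → Finset σ)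
      (anc' : FractionRing (MvPolynomial σ ℂ) → Finset (FractionRing (MvPolynomial σ ℂ))),
      ((∀ x ∈ insert v A', (∃ p q : MvPolynomial σ ℂ, q ≠ 0 ∧
      algebraMap (MvPolynomial σ ℂ) (FractionRing (MvPolynomial σ ℂ)) q * x =
        algebraMap (MvPolynomial σ ℂ) (FractionRing (MvPolynomial σ ℂ)) p ∧
      ∀ w, w ∉ (V' x) → degreeOf w p = 0 ∧ degreeOf w q = 0)) ∧
    (∀ x ∈ insert v A', anc' x ⊆ E') ∧ ((↑E' : Set (FractionRing (MvPolynomial σ ℂ))) ⊆ insert v A') ∧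
    ∀ X : Finset (FractionRing (MvPolynomial σ ℂ)), (↑X : Set (FractionRing (MvPolynomial σ ℂ))) ⊆ insert v A' →
      (X.biUnion V').card ≤ (X.biUnion anc').card + X.card) ∧
      E'.card ≤ E.card + 1 := by
  by_cases hvA : v ∈ A'
  · refine ⟨E, V, anc, ?_, by omega⟩
    rwa [Set.insert_eq_of_mem hvA]
  obtain ⟨a, ha, b, hb, hab⟩ := hv
  obtain ⟨Sa, hSaA, hSa1, ra⟩ := operand_data hI ha
  obtain ⟨Sb, hSbA, hSb1, rb⟩ := operand_data hI hb
  obtain ⟨hR, hAnc, hE, hCnt⟩ := hI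
  -- new data
  set W := Sa.biUnion V ∪ Sb.biUnion V with hW
  set N := insert v (Sa.biUnion anc ∪ Sb.biUnion anc) with hN
  set V' := Function.update V v W with hV'
  set anc' := Function.update anc v N with hanc'
  have hv' :=
    suppRep_step (suppRep_mono ra Finset.subset_union_left)
      (suppRep_mono rb Finset.subset_union_right) hab
  refine ⟨insert v E, V', anc', ⟨?_, ?_, ?_, ?_⟩, by
    calc (insert v E).card ≤ E.card + 1 := Finset.card_insert_le _ _⟩
  · rintro x (rfl | hx)
    · rw [hV', Function.update_self]
      exact hv'
    · have hxv : x ≠ v := fun h => hvA (h ▸ hx)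
      rw [hV', Function.update_of_ne hxv]
      exact hR x hx
  · rintro x (rfl | hx)
    · simp only [hanc', Function.update_self, hN]
      refine Finset.insert_subset_insert _ (Finset.union_subset ?_ ?_)
      · exact Finset.biUnion_subset.2 fun y hy => hAnc y (hSaA hy)
      · exact Finset.biUnion_subset.2 fun y hy => hAnc y (hSbA hy)
    · have hxv : x ≠ v := fun h => hvA (h ▸ hx)
      simp only [hanc', Function.update_of_ne hxv]
      exact (hAnc x hx).trans (Finset.subset_insert _ _)
  · intro y hy
    simp only [Finset.coe_insert, Set.mem_insert_iff] at hy
    rcases hy with rfl | hy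
    · exact Set.mem_insert _ _
    · exact Set.mem_insert_of_mem _ (hE hy)
  · intro X hX
    by_cases hvX : v ∈ X
    swap
    · -- `v ∉ X`: nothing changed on `X`
      have hXA : (↑X : Set _) ⊆ A' := fun x hx => by
        rcases hX hx with h | h
        · exact absurd (h ▸ hx) hvX
        · exact h
      have e1 : X.biUnion V' = X.biUnion V :=
        Finset.biUnion_congr rfl fun x hx => by
          have hxv : x ≠ v := by rintro rfl; exact hvX hx
          rw [hV', Function.update_of_ne hxv]
      have e2 : X.biUnion anc' = X.biUnion anc :=
        Finset.biUnion_congr rfl fun x hx => by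
          have hxv : x ≠ v := by rintro rfl; exact hvX hx
          rw [hanc', Function.update_of_ne hxv]
      rw [e1, e2]
      exact hCnt X hXA
    -- `v ∈ X`: compare with `X' = (X.erase v) ∪ Sa ∪ Sb ⊆ A'`
    set X₀ := X.erase v with hX₀
    set X' := X₀ ∪ (Sa ∪ Sb) with hX'
    have hX₀A : (↑X₀ : Set _) ⊆ A' := fun x hx => by
      have hx' := Finset.mem_coe.1 hx
      rw [hX₀, Finset.mem_erase] at hx'
      rcases hX hx'.2 with h | h
      · exact absurd h hx'.1
      · exact h
    have hX'A : (↑X' : Set _) ⊆ A' := by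
      intro x hx
      have hx' := Finset.mem_coe.1 hx
      rw [hX', Finset.mem_union, Finset.mem_union] at hx'
      rcases hx' with h | h | h
      · exact hX₀A h
      · exact hSaA h
      · exact hSbA h
    -- (S1) supports
    have S1 : X.biUnion V' ⊆ X'.biUnion V := by
      intro y hy
      rw [Finset.mem_biUnion] at hy ⊢
      obtain ⟨x, hx, hyx⟩ := hy
      by_cases hxv : x = v
      · subst hxv
        rw [hV', Function.update_self, hW, Finset.mem_union, Finset.mem_biUnion,
          Finset.mem_biUnion] at hyx
        rcases hyx with ⟨z, hz, hyz⟩ | ⟨z, hz, hyz⟩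
        · exact ⟨z, by rw [hX']; simp [hz], hyz⟩
        · exact ⟨z, by rw [hX']; simp [hz], hyz⟩
      · rw [hV', Function.update_of_ne hxv] at hyx
        exact ⟨x, by rw [hX', hX₀]; simp [hxv, hx], hyx⟩
    -- (S2) ancestors
    have S3 : v ∉ X'.biUnion anc := by
      rw [Finset.mem_biUnion]
      rintro ⟨x, hx, hvx⟩
      exact hvA (hE (hAnc x (hX'A hx) hvx))
    have S2 : insert v (X'.biUnion anc) ⊆ X.biUnion anc' := by
      intro y hy
      rw [Finset.mem_insert] at hy
      rw [Finset.mem_biUnion]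
      rcases hy with rfl | hy
      · exact ⟨y, hvX, by rw [hanc', Function.update_self, hN]; exact Finset.mem_insert_self _ _⟩
      · rw [Finset.mem_biUnion] at hy
        obtain ⟨x, hx, hyx⟩ := hy
        rw [hX', Finset.mem_union, Finset.mem_union] at hx
        rcases hx with hx | hx | hx
        · have hxv : x ≠ v := (Finset.mem_erase.1 hx).1
          exact ⟨x, (Finset.mem_erase.1 hx).2, by rwa [hanc', Function.update_of_ne hxv]⟩
        · refine ⟨v, hvX, ?_⟩
          rw [hanc', Function.update_self, hN, Finset.mem_insert, Finset.mem_union,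
            Finset.mem_biUnion]
          exact Or.inr (Or.inl ⟨x, hx, hyx⟩)
        · refine ⟨v, hvX, ?_⟩
          rw [hanc', Function.update_self, hN, Finset.mem_insert, Finset.mem_union,
            Finset.mem_biUnion, Finset.mem_biUnion]
          exact Or.inr (Or.inr ⟨x, hx, hyx⟩)
    have c1 := Finset.card_le_card S1
    have c2 := Finset.card_le_card S2
    rw [Finset.card_insert_of_notMem S3] at c2
    have c3 := hCnt X' hX'A
    have c4 : X'.card ≤ X₀.card + 2 := by
      calc X'.card ≤ X₀.card + (Sa ∪ Sb).card := Finset.card_union_le _ _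
        _ ≤ X₀.card + (Sa.card + Sb.card) := by gcongr; exact Finset.card_union_le _ _
        _ ≤ X₀.card + 2 := by omega
    have c5 : X₀.card + 1 = X.card := Finset.card_erase_add_one hvX
    omega

end CondensationSoundNeg

end Summit.MatrixMultiplication.MatrixMultiplication.Theorems

end
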